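import Mathlib
import Summits.NavierStokesRegularity.NavierStokesRegularity.Theorems.TypeIQuarterGateQuarterZoomTypeIClockPerSolution
import Summits.NavierStokesRegularity.NavierStokesRegularity.Theorems.GaldiLiouvilleGateParabolicGaldiLiouvilleStubOseenMildOfL6
import Summits.NavierStokesRegularity.NavierStokesRegularity.Theorems.GaldiLiouvilleGateParabolicGaldiLiouvilleStubSobolevSixFrobenius
import Literature.Analysis.FluidPDE.OseenMildSmallRateLiouville
import HarnessLib

/-!
# `TypeIQuarterGate`: the re-typed residual TQAL HAS A PERTURBATIVE REGIME — small Type-I clocks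
# are excluded (Chae–Wolf small-rate Liouville), unlike X2 ⟨0893⟩ (`parabolicGaldiLiouville_iff_small`)

Helper file for the cruxes `QuarterLawTypeI` (stmt-NavierStokesRegularity-23726) and
`ParabolicGaldiLiouville` (stmt-NavierStokesRegularity-0893) of route `TypeIQuarterGate` (theorems
only, no definitions). TQAL ("Type-I-clock Liouville in Galdi's parabolic class", files
`TypeIQuarterGateQuarterZoomTypeIClock`, `…TypeIClockLiouvilleLinks`) is X2 plus the clock
hypothesis `√(−s)‖v(s,y)‖ ≤ C'`. The clock constant is SCALE-INVARIANT, so — in contrast with X2,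
which has no perturbative regime in its own sizes (`ParabolicGaldiLiouvilleScaling.
parabolicGaldiLiouville_iff_small`: sup-norm and enstrophy shrink under the Navier–Stokes scaling) —
TQAL is PROVED for small clocks: the Oseen identity of the X2 class
(`ParabolicGaldiLiouville.Birth.stub_oseenMildOfL6` with the uniform `L⁶` bound from
`stub_sobolevSixFrobenius`, KNSS 2009 Lemma 3.1; cf. `L3Corner.oseenMild`) feeds the tree's small
Type-I-rate Liouville theorem `eq_zero_of_oseenMild_of_small_typeITime` (Chae–Wolf 2017 §3 Step 1).

* `typeIClockLiouville_small_clock` — there is an absolute `ε₀ > 0` such that every bounded ancient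
  mild solution (`ν = 1`), smooth on `(−∞,0) × ℝ³`, with bounded slice enstrophy, `L⁶` slices and
  `√(−s)‖v(s,y)‖ ≤ ε₀` for all `s < 0`, `y`, vanishes identically.
* `QuarterZoomTypeIClock.typeI_constant_not_small_of_quarterLaw` — consequently a non-extendable
  classical Leray–Hopf rapidly-decaying solution that is velocity-Type-I near `T` with constant `C_I`
  and obeys the quarter law has `ε₀ < max C_I 0/√ν` (numerically superseded by the tree's explicit
  threshold `18 − 9√3` of `QuarterLawExponent.typeI_stratum_below_sharp_empty`, which needs no
  quarter law; recorded as the small-clock end of the re-typed residual).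

HONEST FRAMING: the small-clock regime only; TQAL for large clocks is the open Type-I exclusion
problem in Galdi's class; nothing here bears on Navier–Stokes regularity.
References: Chae–Wolf, arXiv:1610.09464 §3; KNSS 2009 Lemma 3.1 and §6.
-/

noncomputable section

set_option linter.dupNamespace false

namespace Summit.NavierStokesRegularity.NavierStokesRegularity.Theorems

open Set MeasureTheory Filter Topology Function
open scoped ENNReal NNReal
open Literature.Analysis.FluidPDE

/-- **TQAL in the small-clock regime.** There is an absolute `ε₀ > 0` such that every bounded
ancient mild solution `v` (`ν = 1`), smooth on `(−∞,0) × ℝ³`, with uniformly bounded slice enstrophy,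
`L⁶` slices and the small Type-I clock `√(−s)‖v(s,y)‖ ≤ ε₀` (all `s < 0`, `y`) vanishes identically:
the class solves the Oseen integral equation (`stub_oseenMildOfL6`), to which the small-rate
Liouville theorem `eq_zero_of_oseenMild_of_small_typeITime` applies.
[cite: ChaeWolf2017RemovingDSS, §3 Step 1] [cite: KochNadirashviliSereginSverak2009, Lemma 3.1] -/
theorem typeIClockLiouville_small_clock :
    ∃ ε₀ : ℝ, 0 < ε₀ ∧ ∀ v : ℝ → EuclideanSpace ℝ (Fin 3) → EuclideanSpace ℝ (Fin 3),
      IsBoundedAncientMildSolution 1 v →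
      ContDiffOn ℝ (⊤ : ℕ∞) (Function.uncurry v) (Set.Iio 0 ×ˢ Set.univ) →
      (∃ C : NNReal, ∀ s < 0,
        ∫⁻ y, ENNReal.ofReal (frobeniusNormSq (fderiv ℝ (v s) y)) ≤ C) →
      (∀ s < 0, MemLp (v s) 6 volume) →
      (∀ s < 0, ∀ y, Real.sqrt (-s) * ‖v s y‖ ≤ ε₀) →
      ∀ s < 0, ∀ y, v s y = 0 := by
  obtain ⟨ε₀, hε₀, hsmall⟩ := eq_zero_of_oseenMild_of_small_typeITime
  refine ⟨ε₀, hε₀, fun v hv hsm hens hL6 hclock => ?_⟩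
  -- the uniform `L⁶` bound of the slices (Sobolev on `C¹` slices with bounded enstrophy)
  have hslice : ∀ s < 0, ContDiff ℝ 1 (v s) := fun s hs => by
    have h : ContDiff ℝ (⊤ : ℕ∞) (uncurry v ∘ fun y : EuclideanSpace ℝ (Fin 3) => (s, y)) :=
      hsm.comp_contDiff (contDiff_const.prodMk contDiff_id) fun y => ⟨hs, Set.mem_univ y⟩
    exact h.of_le (by exact_mod_cast le_top)
  obtain ⟨KS, hKS⟩ := ParabolicGaldiLiouville.Birth.stub_sobolevSixFrobenius
  obtain ⟨C, hC⟩ := hens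
  have hfin : (KS : ℝ≥0∞) * (C : ℝ≥0∞) ^ (1 / 2 : ℝ) ≠ ⊤ :=
    ENNReal.mul_ne_top ENNReal.coe_ne_top
      (ENNReal.rpow_ne_top_of_nonneg (by norm_num) ENNReal.coe_ne_top)
  have hK6 : ∃ K : NNReal, ∀ s < 0, eLpNorm (v s) 6 volume ≤ K := by
    refine ⟨((KS : ℝ≥0∞) * (C : ℝ≥0∞) ^ (1 / 2 : ℝ)).toNNReal, fun s hs => ?_⟩
    rw [ENNReal.coe_toNNReal hfin]
    exact (hKS (v s) (hslice s hs) (hL6 s hs)).trans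
      (mul_le_mul' le_rfl (ENNReal.rpow_le_rpow (hC s hs) (by norm_num)))
  have hoseen := ParabolicGaldiLiouville.Birth.stub_oseenMildOfL6 v hv hsm.continuousOn hK6
  refine hsmall (u := v) (fun s t hst ht0 x => ?_) hclock
  rw [heatFlow_of_pos _ (sub_pos.2 hst), hoseen s t hst ht0 x, oseenDuhamel_apply]
  simp only [one_mul]

namespace QuarterZoomTypeIClock

/-- **A Type-I blow-up obeying the quarter law has dimensionless constant above `ε₀`.** For a
classical Leray–Hopf solution on `[0,T)` from a rapidly decaying datum with no smooth extension past
`T`, velocity-Type-I near `T` with constant `C_I` and obeying the quarter law with constant `K`,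
`ε₀ < max C_I 0/√ν` (`ε₀` of `typeIClockLiouville_small_clock`): otherwise the zoom limit of
`quarterZoom_typeIClock_of_rate` has a small clock and vanishes, contradicting its non-triviality.
(Numerically superseded by the quarter-law-free threshold `18 − 9√3` in the tree.)
[cite: KochNadirashviliSereginSverak2009, §6] -/
theorem typeI_constant_not_small_of_quarterLaw :
    ∃ ε₀ : ℝ, 0 < ε₀ ∧ ∀ (ν T : ℝ), 0 < ν → 0 < T →
      ∀ (u : ℝ → EuclideanSpace ℝ (Fin 3) → EuclideanSpace ℝ (Fin 3))
        (p : ℝ → EuclideanSpace ℝ (Fin 3) → ℝ),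
        IsClassicalNSSolutionOn (Set.Ico 0 T) ν 0 u p → IsLerayHopfOn T ν 0 (u 0) u →
        HasRapidSpatialDecay (u 0) → ¬ HasSmoothExtensionPast ν 0 u T →
        ∀ CI : ℝ, (∀ᶠ t in 𝓝[<] T, ∀ x, ‖u t x‖ ≤ CI / Real.sqrt (T - t)) →
        ∀ K : ℝ, (∀ t ∈ Set.Ico 0 T,
          ∫⁻ x, ‖curl (u t) x‖ₑ ^ 2 ≤ ENNReal.ofReal (K / Real.sqrt (T - t))) →
        ε₀ < max CI 0 / Real.sqrt ν := by
  obtain ⟨ε₀, hε₀, hsmall⟩ := typeIClockLiouville_small_clock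
  refine ⟨ε₀, hε₀, fun ν T hν hT u p hcl hLH hdec hnext CI hCI K hK => ?_⟩
  by_contra hle
  rw [not_lt] at hle
  obtain ⟨v, hv, hsm, hens, hL6, hne, hclock⟩ :=
    quarterZoom_typeIClock_of_rate ν T hν hT u p hcl hLH hdec hnext CI hCI K hK
  exact hne (hsmall v hv hsm ⟨1, fun s hs => le_of_le_of_eq (hens s hs) ENNReal.coe_one.symm⟩ hL6
    fun s hs y => (hclock s hs y).trans hle)

end QuarterZoomTypeIClock

end Summit.NavierStokesRegularity.NavierStokesRegularity.Theorems

end
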